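import Literature.Geometry.Lorentzian.EndCompactificationEnd
import Literature.Geometry.Lorentzian.MassCapacityRigidityHarmonic
import HarnessLib

/-!
# The potential of Bray's Thm. 8 is positive, and so is the monopole coefficient of the
# compactified factor (the maximum-principle facts implicit in the proof of Thm. 8)

Bray, J. Differential Geom. 59 (2001) 177–267, §6: the `ḡ`-harmonic function `φ` of (81)/(86)
(`φ → 1` in the chosen end, `φ → 0` in the other ends) is used as a conformal factor,
`g̃ = φ⁴ ḡ`, and in each compactified end *"the conformal factor being a bounded harmonic
function to the fourth power in the punctured ball … can be extended to the whole ball, which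
proves that the metric `g̃` can be extended smoothly over all of the points at infinity"*. Two
facts are implicit here: `φ > 0` (so that `φ⁴ ḡ` is a metric) and the positivity of the extended
factor at `∞_k`, i.e. of the monopole coefficient `b` of the flat-harmonic function
`V = 𝒰 · (φ ∘ Φ) = b/r + O(r⁻²)` (`W(0) = b` for its Kelvin transform `W`). Both follow from the
maximum principle, and this file proves them, removing the corresponding hypotheses `hφpos`,
`hb` from `AFEnd.Bray2001_thm8_two_ends_of_positiveMass` and
`AFEnd.half_horizonCapacity_le_admEnergy_of_symmetric_of_positiveMass`
(`EndCompactificationEnd.lean`):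

* `AFEnd.frontier_far_subset`, `isCompact_dataChart_image_sphere`, `isExteriorRegion_far` —
  the far regions `e.far R₁` (`R₁ > R`) are exterior regions of the end (connected, bounded by
  the compact coordinate sphere `Φ{|z| = R₁}`), so that the minimum principle
  `IsExteriorRegion.nonneg_of_dalembertian_nonpos` applies to them;
* `pos_of_harmonic_twoEnds` — **`φ > 0`**: on a connected manifold with exactly two ends, an
  `h`-harmonic `C²` function tending to `1` in one end and to `0` in the other is positive
  (`φ ≥ 0` by the two-ended minimum principle `nonneg_of_dalembertian_nonpos_twoEnds`; a zero
  would make `φ` constant by E. Hopf, `dalembertian_supersolution_eq_of_exists_eq`);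
* `IsHarmonicallyFlatWith.dalembertian_factor_inv_mul_inv_norm` — on a harmonically flat end the
  function `σ = (𝒰 r)⁻¹ ∘ coord` is `h`-harmonic far out (`𝒰 σ̂ = 1/r` is flat-harmonic and
  `Δ_δ(𝒰 F) = 𝒰⁵ Δ_{𝒰⁴δ} F + F Δ_δ 𝒰`, `MetricCoord.laplacian_mul_eq_of_conformal`);
* `IsHarmonicallyFlatWith.monopole_pos_of_pos` — **`b > 0`**: for `φ > 0` `h`-harmonic far out in
  a harmonically flat end with `φ → 0` there, the expansion `𝒰 · (φ ∘ Φ) = b/r + O(r⁻²)` has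
  `b > 0`: by the minimum principle on the exterior region `e.far R`, `φ ≥ ε σ` there for a small
  `ε > 0` (comparison on the coordinate sphere `|z| = R`, both sides tend to `0`), i.e.
  `𝒰 · (φ ∘ Φ) ≥ ε/r`, whence `b ≥ ε`;
* `AFEnd.Bray2001_thm8_two_ends_of_positiveMass'`,
  `AFEnd.half_horizonCapacity_le_admEnergy_of_symmetric_of_positiveMass'` — the two theorems of
  `EndCompactificationEnd.lean` without the hypotheses `hφpos`, `hb`.

Everything is proved; nothing is defined and no named fact is introduced.

## References

* H. L. Bray, *Proof of the Riemannian Penrose inequality using the positive mass theorem*,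
  J. Differential Geom. 59 (2001) 177–267 (arXiv:math/9911173), §6, (81), (86), proof of Thm. 8.
  [BrayRPI2001]
* J. López-Gómez, *Linear Second Order Elliptic Operators*, World Scientific 2013, Thm. 1.2
  (E. Hopf's minimum principle). [LopezGomez2012]
-/

noncomputable section

open Set Function Metric TopologicalSpace Filter Topology Bundle Bornology Asymptotics
  InnerProductSpace
open scoped Manifold ContDiff Topology Laplacian

namespace Literature.Geometry.Lorentzian

open PseudoRiemannianMetric

namespace AFEnd

/-! ### Far regions are exterior regions -/

section Far

variable {X : Type} [TopologicalSpace X] [ChartedSpace E3 X] (e : AFEnd X)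

/-- The boundary of a far region lies on the coordinate sphere: `∂(far R₁) ⊆ Φ{|z| = R₁}`
(`R < R₁`). [folklore] -/
theorem frontier_far_subset {R₁ : ℝ} (hR₁ : e.R < R₁) :
    frontier (e.far R₁) ⊆ e.dataChart '' {z : exteriorRegion e.R | ‖(z : E3)‖ = R₁} := by
  intro x hx
  rw [(e.isOpen_far R₁).frontier_eq] at hx
  obtain ⟨hcl, hnot⟩ := hx
  obtain ⟨hxU, hge⟩ := e.mem_image_preimage_le_norm_iff.1 (e.closure_far_subset hR₁ hcl)
  have hle : ‖e.coord x‖ ≤ R₁ := le_of_not_gt fun h ↦ hnot (e.mem_far_of_lt_norm_coord hxU h)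
  exact ⟨⟨e.coord x, e.lt_norm_coord hxU⟩, le_antisymm hle hge, e.dataChart_coord hxU⟩

/-- The coordinate spheres `Φ{|z| = R₁}` (`R < R₁`) are compact. [folklore] -/
theorem isCompact_dataChart_image_sphere {R₁ : ℝ} (hR₁ : e.R < R₁) :
    IsCompact (e.dataChart '' {z : exteriorRegion e.R | ‖(z : E3)‖ = R₁}) := by
  have hset : {z : exteriorRegion e.R | ‖(z : E3)‖ = R₁} =
      {z : exteriorRegion e.R | R₁ ≤ ‖(z : E3)‖ ∧ ‖(z : E3)‖ ≤ R₁} :=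
    Set.ext fun z ↦ ⟨fun h ↦ ⟨h.ge, h.le⟩, fun h ↦ le_antisymm h.2 h.1⟩
  rw [hset]
  exact e.isCompact_dataChart_image_annulus hR₁ R₁

/-- The coordinate spheres `Φ{|z| = R₁}` (`R < R₁`) are nonempty. [folklore] -/
theorem dataChart_image_sphere_nonempty {R₁ : ℝ} (hR₁ : e.R < R₁) :
    (e.dataChart '' {z : exteriorRegion e.R | ‖(z : E3)‖ = R₁}).Nonempty := by
  obtain ⟨x, hx⟩ := (NormedSpace.sphere_nonempty (E := E3) (x := 0) (r := R₁)).2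
    (e.R_pos.trans hR₁).le
  rw [mem_sphere_zero_iff_norm] at hx
  exact ⟨_, ⟨⟨x, by rw [mem_exteriorRegion, hx]; exact hR₁⟩, hx, rfl⟩⟩

/-- **Far regions are exterior regions of the end**: `e.far R₁` (`R < R₁`) is connected,
contains a far region, and `closure (far R₁) ∖ far R₁ ⊆ Φ{|z| = R₁}` is compact — so the
minimum principle `IsExteriorRegion.nonneg_of_dalembertian_nonpos` applies on it, with boundary
values on the coordinate sphere. Huisken–Ilmanen 2001, §0 (exterior regions); Bartnik 1986, §1.
[folklore] -/
theorem isExteriorRegion_far {R₁ : ℝ} (hR₁ : e.R < R₁) :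
    IsExteriorRegion e ⟨e.far R₁, e.isOpen_far R₁⟩ := by
  refine ⟨⟨AFEnd.far_nonempty e R₁, e.isPreconnected_far hR₁.le⟩, R₁, hR₁, subset_rfl, ?_⟩
  have hcl : IsClosed (closure (e.far R₁) \ e.far R₁) := isClosed_closure.sdiff (e.isOpen_far R₁)
  refine (e.isCompact_dataChart_image_sphere hR₁).of_isClosed_subset hcl fun x hx ↦ ?_
  have hfr : x ∈ frontier (e.far R₁) := by
    rw [(e.isOpen_far R₁).frontier_eq]
    exact hx
  exact e.frontier_far_subset hR₁ hfr

end Far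

/-! ### The two-ended potential is positive -/

section Positivity

variable {X : Type} [TopologicalSpace X] [ChartedSpace E3 X] [IsManifold (𝓡 3) ∞ X]

/-- **The potential of (81) is positive.** On a connected manifold with exactly two ends `e₁`,
`e₂` (the complement of the union of any two far regions is compact), a `C²` function `φ` with
`Δ_h φ = 0`, `φ → 1` in `e₁` and `φ → 0` in `e₂` satisfies `φ > 0`: `φ ≥ 0` by the two-ended
minimum principle, and if `φ(x₀) = 0` then `0` is a global minimum, so `φ ≡ 0` by E. Hopf's
minimum principle — impossible in `e₁`. Bray 2001, §6, (81) and the use of `φ⁴ ḡ` as a metric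
in the proof of Thm. 8. [cite: BrayRPI2001, §6 (81)] [cite: LopezGomez2012, Thm. 1.2] -/
theorem pos_of_harmonic_twoEnds [ConnectedSpace X] (D : InitialDataSet (𝓡 3) X)
    [D.metric.HasLeviCivita] {e₁ e₂ : AFEnd X}
    (htwo : ∀ R₁ R₂, IsCompact (e₁.far R₁ ∪ e₂.far R₂)ᶜ) {φ : X → ℝ}
    (hφ : ContMDiff (𝓡 3) 𝓘(ℝ, ℝ) 2 φ) (hΔ : ∀ x, D.metric.dalembertian φ x = 0)
    (h1 : TendstoAtEnd e₁ φ 1) (h0 : TendstoAtEnd e₂ φ 0) : ∀ x, 0 < φ x := by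
  haveI : (ofRiemannian D.h).HasLeviCivita := ‹D.metric.HasLeviCivita›
  have hnn : ∀ x, 0 ≤ φ x :=
    nonneg_of_dalembertian_nonpos_twoEnds D.h htwo hφ (fun x ↦ (hΔ x).le)
      (fun ε hε ↦ by
        obtain ⟨R, -, hR⟩ := h1.exists_radius_lt (show -ε < 1 by linarith)
        exact ⟨R, hR⟩)
      (fun ε hε ↦ by
        obtain ⟨R, -, hR⟩ := h0.exists_radius_lt (show -ε < 0 by linarith)
        exact ⟨R, hR⟩)
  intro x₀
  by_contra hx₀
  have h00 : φ x₀ = 0 := le_antisymm (le_of_not_gt hx₀) (hnn x₀)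
  have hall := (ofRiemannian D.h).dalembertian_supersolution_eq_of_exists_eq
    (isRiemannian_ofRiemannian D.h) (c := fun _ ↦ 0) continuous_const (fun _ ↦ le_rfl) hφ
    (fun x ↦ by rw [zero_mul]; exact (hΔ x).le) le_rfl hnn h00
  obtain ⟨R, -, hR⟩ := h1.exists_radius_lt (show (1 : ℝ) / 2 < 1 by norm_num)
  obtain ⟨x₂, hx₂⟩ := AFEnd.far_nonempty e₁ R
  have h2 := hR x₂ hx₂
  rw [hall x₂] at h2
  linarith

end Positivity

/-! ### The monopole coefficient of `𝒰 · φ` in a compactified end is positive -/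

namespace IsHarmonicallyFlatWith

variable {X : Type} [TopologicalSpace X] [ChartedSpace E3 X] [IsManifold (𝓡 3) ∞ X]
  {e : AFEnd X} {D : InitialDataSet (𝓡 3) X} [D.metric.HasLeviCivita] {R₁ : ℝ} {𝒰 : E3 → ℝ}

/-- **`σ = (𝒰 r)⁻¹ ∘ coord` is smooth on the shell of a harmonically flat end** (beyond
`max R₁ 0`: `coord` is smooth on the end, `𝒰` is smooth and positive beyond `R₁`, `r` is smooth
off the origin). [folklore] -/
theorem contMDiffAt_factor_inv_mul_inv_norm (hHF : e.IsHarmonicallyFlatWith D R₁ 𝒰) {q : X}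
    (hq : q ∈ e.U) (hq₁ : R₁ < ‖e.coord q‖) :
    ContMDiffAt (𝓡 3) 𝓘(ℝ, ℝ) ∞ (fun x ↦ (𝒰 (e.coord x) * ‖e.coord x‖)⁻¹) q := by
  have h0 : e.coord q ≠ 0 := by
    intro h
    rw [h, norm_zero] at hq₁
    have := e.lt_norm_coord hq
    rw [h, norm_zero] at this
    exact lt_irrefl _ (this.trans e.R_pos)
  have hg : ContDiffAt ℝ ∞ (fun z : E3 ↦ (𝒰 z * ‖z‖)⁻¹) (e.coord q) := by
    refine ((hHF.contDiffAt_factor hq₁).mul (contDiffAt_norm ℝ h0)).inv ?_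
    exact mul_ne_zero (hHF.pos hq₁).ne' (norm_ne_zero_iff.2 h0)
  exact hg.comp_contMDiffAt (e.contMDiffAt_coord hq)

/-- **`σ = (𝒰 r)⁻¹ ∘ coord` is `h`-harmonic far out in a harmonically flat end**: at `Φ z`,
`|z| > max R₁ 0`, `Δ_h σ = 0`. In the chart `Δ_h σ (Φ z) = Δ_{𝒰⁴δ} σ̂ (z)`
(`dalembertian_dataChart_eq_lapAt_endValue`) and
`𝒰⁵ Δ_{𝒰⁴δ} σ̂ = Δ_δ(𝒰 σ̂) − σ̂ Δ_δ 𝒰 = Δ_δ(1/r) − 0 = 0`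
(`MetricCoord.laplacian_mul_eq_of_conformal`, `harmonicOnNhd_inv_norm`). This is the
`ḡ`-harmonic comparison function `c/(𝒰 r)` of a harmonically flat end (Bray's ends are
`𝒰⁴ δ` with `𝒰` harmonic, §2 (9)). [cite: BrayRPI2001, §2 (9)–(10)] -/
theorem dalembertian_factor_inv_mul_inv_norm (hHF : e.IsHarmonicallyFlatWith D R₁ 𝒰)
    (z : exteriorRegion e.R) (hz₁ : R₁ < ‖(z : E3)‖) :
    D.metric.dalembertian (fun x ↦ (𝒰 (e.coord x) * ‖e.coord x‖)⁻¹) (e.dataChart z) = 0 := by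
  set σ : X → ℝ := fun x ↦ (𝒰 (e.coord x) * ‖e.coord x‖)⁻¹ with hσ_def
  have hzR : e.R < ‖(z : E3)‖ := z.2
  have hz0 : 0 < ‖(z : E3)‖ := e.R_pos.trans hzR
  have hqU : e.dataChart z ∈ e.U := (e.chart.symm z).2
  have hcz : e.coord (e.dataChart z) = z := e.coord_dataChart z
  have hσs : ContMDiffAt (𝓡 3) 𝓘(ℝ, ℝ) ∞ σ (e.dataChart z) :=
    hHF.contMDiffAt_factor_inv_mul_inv_norm hqU (by rw [hcz]; exact hz₁)
  have h2le : ((2 : ℕ) : ℕ∞ω) ≤ ∞ := WithTop.coe_le_coe.mpr le_top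
  rw [e.dalembertian_dataChart_eq_lapAt_endValue D z (hσs.of_le h2le)]
  -- the shell `V = {max R₁ 0 < |w|}` and the representative `σ̂ = (𝒰 r)⁻¹` there
  set V : Set E3 := {w | max R₁ 0 < ‖w‖} with hV_def
  have hVo : IsOpen V := isOpen_lt continuous_const continuous_norm
  have hV1 : ∀ w ∈ V, R₁ < ‖w‖ := fun w hw ↦ lt_of_le_of_lt (le_max_left _ _) hw
  have hV0 : ∀ w ∈ V, w ≠ 0 := fun w hw h ↦ by
    have hw' : max R₁ 0 < ‖w‖ := hw
    rw [h, norm_zero] at hw'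
    exact lt_irrefl _ (lt_of_le_of_lt (le_max_right R₁ 0) hw')
  have hVR : ∀ w ∈ V, e.R < ‖w‖ := fun w hw ↦ lt_of_le_of_lt hHF.le_radius (hV1 w hw)
  have hzV : (z : E3) ∈ V := max_lt hz₁ hz0
  have hw : ContDiffOn ℝ ∞ 𝒰 V := hHF.contDiffOn_factor.mono fun w hw ↦ hV1 w hw
  have hw0 : ∀ w ∈ V, 𝒰 w ≠ 0 := fun w hw ↦ (hHF.pos (hV1 w hw)).ne'
  have hrepr : ∀ w ∈ V, endValue e σ w = (𝒰 w * ‖w‖)⁻¹ := fun w hw ↦ by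
    rw [endValue_of_lt e σ (hVR w hw), hσ_def]
    simp only [e.coord_dataChart]
  -- `𝒰 σ̂ = 1/r` near `z`
  have hprod : (fun w ↦ 𝒰 w * endValue e σ w) =ᶠ[𝓝 (z : E3)] fun w ↦ ‖w‖⁻¹ := by
    filter_upwards [hVo.mem_nhds hzV] with w hw
    rw [hrepr w hw, mul_inv, ← mul_assoc, mul_inv_cancel₀ (hw0 w hw), one_mul]
  have hF2 : ContDiffAt ℝ 2 (endValue e σ) z := by
    have h : ContDiffAt ℝ 2 (fun w : E3 ↦ (𝒰 w * ‖w‖)⁻¹) z :=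
      ((((hw z hzV).contDiffAt (hVo.mem_nhds hzV)).mul (contDiffAt_norm ℝ (hV0 z hzV))).inv
        (mul_ne_zero (hw0 z hzV) (norm_ne_zero_iff.2 (hV0 z hzV)))).of_le h2le
    refine h.congr_of_eventuallyEq ?_
    filter_upwards [hVo.mem_nhds hzV] with w hw
    exact hrepr w hw
  -- the conformal identity at `z`
  set b := stdOrthonormalBasis ℝ E3
  have hcard : Fintype.card (Fin (Module.finrank ℝ E3)) = 3 := by
    rw [Fintype.card_fin, finrank_euclideanSpace_fin]
  have key := MetricCoord.laplacian_mul_eq_of_conformal b hcard hVo hw hw0 hzV hF2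
  have hΔ1 : (Δ fun w ↦ 𝒰 w * endValue e σ w) (z : E3) = 0 := by
    rw [(laplacian_congr_nhds hprod).eq_of_nhds]
    exact (harmonicOnNhd_inv_norm (z : E3) (hV0 z hzV)).2.eq_of_nhds
  have hΔ𝒰 : (Δ 𝒰) (z : E3) = 0 := (hHF.harmonicOnNhd z hz₁).2.eq_of_nhds
  rw [hΔ1, hΔ𝒰, mul_zero, add_zero] at key
  -- `lapAt (hCoeff) = lapAt (𝒰⁴ δ)` at `z`
  have hcongr : hCoeff e D =ᶠ[𝓝 (z : E3)]
      fun w ↦ 𝒰 w ^ 4 • (innerSL ℝ (E := E3) : E3 →L[ℝ] E3 →L[ℝ] ℝ) := by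
    filter_upwards [(isOpen_lt continuous_const continuous_norm).mem_nhds hz₁] with w hw'
    exact hHF.hCoeff_eq hw'
  rw [MetricCoord.lapAt_congr_metric hcongr]
  have h5 : 𝒰 z ^ 5 ≠ 0 := pow_ne_zero 5 (hw0 z hzV)
  exact (mul_eq_zero.1 key.symm).resolve_left h5

/-- **The monopole coefficient of `𝒰 · (φ ∘ Φ)` is positive** for a positive `h`-harmonic `φ`
in a harmonically flat end (the positivity at `∞_k` of the extended conformal factor in Bray's
proof of Thm. 8). If `φ > 0` is `C²` with `Δ_h φ = 0` beyond `R₂` in the end and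
`𝒰 · (φ ∘ Φ) = b/r + O(r⁻²)` (so `φ → 0` there), then `b > 0`. Proof: with `𝒰 → a > 0`, choose
`R` beyond all radii with `𝒰 > a/2` on `{|z| ≥ R}`, let `m₀ > 0` be the minimum of `φ` on the
coordinate sphere `Φ{|z| = R}` and `ε = m₀ a R/2`; then `u = φ − ε σ`, `σ = (𝒰 r)⁻¹ ∘ coord`, is
`h`-harmonic on the exterior region `far R`, `≥ 0` on its boundary and `→ 0` at infinity, so
`u ≥ 0` there (`IsExteriorRegion.nonneg_of_dalembertian_nonpos`): `𝒰 · (φ ∘ Φ) ≥ ε/r`, and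
`b ≥ ε` follows from the expansion. [cite: BrayRPI2001, §6 proof of Thm. 8]
[cite: LopezGomez2012, Thm. 1.2] -/
theorem monopole_pos_of_pos (hHF : e.IsHarmonicallyFlatWith D R₁ 𝒰) {φ : X → ℝ}
    (hφ : ContMDiff (𝓡 3) 𝓘(ℝ, ℝ) 2 φ) {R₂ : ℝ}
    (hΔ : ∀ y : exteriorRegion e.R, R₂ < ‖(y : E3)‖ → D.metric.dalembertian φ (e.dataChart y) = 0)
    (hpos : ∀ x, 0 < φ x) {b : ℝ}
    (hb : HasHarmonicExpansion (fun x ↦ 𝒰 x * endValue e φ x) 0 b) : 0 < b := by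
  haveI : (ofRiemannian D.h).HasLeviCivita := ‹D.metric.HasLeviCivita›
  obtain ⟨a, ha, h𝒰a⟩ := hHF.exists_tendsto
  -- `𝒰 > a/2` beyond `R₃`
  have hev : ∀ᶠ z in cobounded E3, a / 2 < 𝒰 z := h𝒰a.eventually (lt_mem_nhds (by linarith))
  obtain ⟨R₃, hR₃⟩ := exists_radius_of_eventually_cobounded hev
  -- the radius `R`
  set R : ℝ := max (max R₁ R₂) (max R₃ e.R) + 1 with hR_def
  have hRR₁ : R₁ < R := by
    have := (le_max_left R₁ R₂).trans (le_max_left (max R₁ R₂) (max R₃ e.R)); rw [hR_def]; linarith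
  have hRR₂ : R₂ < R := by
    have := (le_max_right R₁ R₂).trans (le_max_left (max R₁ R₂) (max R₃ e.R)); rw [hR_def]; linarith
  have hRR₃ : R₃ < R := by
    have := (le_max_left R₃ e.R).trans (le_max_right (max R₁ R₂) (max R₃ e.R)); rw [hR_def]; linarith
  have hRe : e.R < R := by
    have := (le_max_right R₃ e.R).trans (le_max_right (max R₁ R₂) (max R₃ e.R)); rw [hR_def]; linarith
  have hR0 : 0 < R := e.R_pos.trans hRe
  -- the comparison function
  set σ : X → ℝ := fun x ↦ (𝒰 (e.coord x) * ‖e.coord x‖)⁻¹ with hσ_def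
  -- values of `σ` : positive, `≤ 2/(a ρ)` where `|coord| = ρ ≥ R`
  have hσle : ∀ x ∈ e.U, R ≤ ‖e.coord x‖ → 0 < σ x ∧ σ x ≤ 2 / (a * ‖e.coord x‖) := by
    intro x hxU hxR
    have h1 : R₁ < ‖e.coord x‖ := hRR₁.trans_le hxR
    have h3 : a / 2 < 𝒰 (e.coord x) := hR₃ _ (hRR₃.trans_le hxR)
    have hρ : 0 < ‖e.coord x‖ := hR0.trans_le hxR
    have h𝒰 : 0 < 𝒰 (e.coord x) := hHF.pos h1
    refine ⟨?_, ?_⟩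
    · show 0 < (𝒰 (e.coord x) * ‖e.coord x‖)⁻¹
      positivity
    show (𝒰 (e.coord x) * ‖e.coord x‖)⁻¹ ≤ 2 / (a * ‖e.coord x‖)
    rw [inv_eq_one_div, div_le_div_iff₀ (by positivity) (by positivity)]
    nlinarith
  -- the coordinate sphere `K = Φ{|z| = R}` and the minimum of `φ` on it
  set K : Set X := e.dataChart '' {z : exteriorRegion e.R | ‖(z : E3)‖ = R} with hK_def
  have hKc : IsCompact K := e.isCompact_dataChart_image_sphere hRe
  obtain ⟨xm, hxmK, hmin⟩ := hKc.exists_isMinOn (e.dataChart_image_sphere_nonempty hRe)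
    hφ.continuous.continuousOn
  set m₀ : ℝ := φ xm with hm₀_def
  have hm₀ : 0 < m₀ := hpos xm
  set ε : ℝ := m₀ * a * R / 2 with hε_def
  have hε : 0 < ε := by rw [hε_def]; positivity
  -- the exterior region `far R`
  set U₀ : Opens X := ⟨e.far R, e.isOpen_far R⟩ with hU₀_def
  have hU₀ : IsExteriorRegion e U₀ := e.isExteriorRegion_far hRe
  have hfarU' : ∀ x ∈ e.far R, ∃ _ : x ∈ e.U, R < ‖e.coord x‖ := fun x hx ↦
    e.mem_far_iff_coord.1 hx
  -- smoothness of `σ` near the closed far piece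
  have hσs : ∀ x ∈ e.U, R₁ < ‖e.coord x‖ → ContMDiffAt (𝓡 3) 𝓘(ℝ, ℝ) ∞ σ x := fun x hxU hx₁ ↦
    hHF.contMDiffAt_factor_inv_mul_inv_norm hxU hx₁
  have h2le : ((2 : ℕ) : ℕ∞ω) ≤ ∞ := WithTop.coe_le_coe.mpr le_top
  set u : X → ℝ := fun x ↦ φ x - (ε * σ x + 0) with hu_def
  have hu_eq : u = φ - fun x ↦ ε * σ x + 0 := rfl
  -- (i) continuity on the closure
  have huc : ContinuousOn u (closure (U₀ : Set X)) := by
    refine continuousOn_of_forall_continuousAt fun x hx ↦ ?_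
    obtain ⟨hxU, hxR⟩ := e.mem_image_preimage_le_norm_iff.1 (e.closure_far_subset hRe hx)
    have hσc : ContinuousAt σ x := (hσs x hxU (hRR₁.trans_le hxR)).continuousAt
    exact (hφ.continuous.continuousAt).sub ((continuousAt_const.mul hσc).add continuousAt_const)
  -- (ii) `C²` on `far R`
  have hu2 : ContMDiffOn (𝓡 3) 𝓘(ℝ, ℝ) 2 u (U₀ : Set X) := fun x hx ↦ by
    obtain ⟨hxU, hxR⟩ := hfarU' x hx
    have hσ2 : ContMDiffAt (𝓡 3) 𝓘(ℝ, ℝ) 2 σ x := (hσs x hxU (hRR₁.trans hxR)).of_le h2le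
    exact ((hφ x).sub ((contMDiffAt_const.mul hσ2).add contMDiffAt_const)).contMDiffWithinAt
  -- (iii) `Δ_h u = 0` on `far R`
  have hΔu : ∀ x ∈ (U₀ : Set X), (ofRiemannian D.h).dalembertian u x ≤ 0 := by
    intro x hx
    obtain ⟨z, hzR, rfl⟩ := e.mem_far_iff.1 hx
    have hσ2 : ContMDiffAt (𝓡 3) 𝓘(ℝ, ℝ) 2 σ (e.dataChart z) := by
      obtain ⟨hxU, hxR⟩ := hfarU' _ hx
      exact (hσs _ hxU (hRR₁.trans hxR)).of_le h2le
    have hτ2 : ContMDiffAt (𝓡 3) 𝓘(ℝ, ℝ) 2 (fun y ↦ ε * σ y + 0) (e.dataChart z) :=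
      (contMDiffAt_const.mul hσ2).add contMDiffAt_const
    rw [hu_eq, dalembertian_sub (ofRiemannian D.h) (hφ _) hτ2,
      dalembertian_affine_apply D.h ε 0 hσ2]
    have h1 : (ofRiemannian D.h).dalembertian φ (e.dataChart z) = 0 := hΔ z (hRR₂.trans hzR)
    have h2 : (ofRiemannian D.h).dalembertian σ (e.dataChart z) = 0 :=
      hHF.dalembertian_factor_inv_mul_inv_norm z (hRR₁.trans hzR)
    rw [h1, h2, mul_zero, sub_zero]
  -- (iv) `u ≥ 0` on the boundary sphere
  have hbdry : ∀ x ∈ frontier (U₀ : Set X), 0 ≤ u x := by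
    intro x hx
    have hxK : x ∈ K := e.frontier_far_subset hRe hx
    obtain ⟨z, hz, rfl⟩ := hxK
    have hzR : ‖(z : E3)‖ = R := hz
    have hxU : e.dataChart z ∈ e.U := (e.chart.symm z).2
    have hcz : e.coord (e.dataChart z) = z := e.coord_dataChart z
    have hge : R ≤ ‖e.coord (e.dataChart z)‖ := by rw [hcz, hzR]
    obtain ⟨-, hσb⟩ := hσle _ hxU hge
    rw [hcz, hzR] at hσb
    have hφm : m₀ ≤ φ (e.dataChart z) := hmin ⟨z, hz, rfl⟩
    have hεσ : ε * σ (e.dataChart z) ≤ m₀ := by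
      calc ε * σ (e.dataChart z) ≤ ε * (2 / (a * R)) :=
            mul_le_mul_of_nonneg_left hσb hε.le
        _ = m₀ := by rw [hε_def]; field_simp
    show 0 ≤ φ (e.dataChart z) - (ε * σ (e.dataChart z) + 0)
    linarith
  -- (v) `liminf u ≥ 0` at infinity
  have hinf : ∀ ε' : ℝ, 0 < ε' → ∃ R', ∀ x ∈ e.far R', -ε' < u x := by
    intro ε' hε'
    refine ⟨max R (2 * ε / (a * ε')), fun x hx ↦ ?_⟩
    obtain ⟨hxU, hxM⟩ := e.mem_far_iff_coord.1 hx
    have hρR : R ≤ ‖e.coord x‖ := (le_max_left _ _).trans hxM.le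
    have hρ2 : 2 * ε / (a * ε') < ‖e.coord x‖ := (le_max_right _ _).trans_lt hxM
    obtain ⟨-, hσb⟩ := hσle x hxU hρR
    have hρ : 0 < ‖e.coord x‖ := hR0.trans_le hρR
    have hεσ : ε * σ x < ε' := by
      calc ε * σ x ≤ ε * (2 / (a * ‖e.coord x‖)) := mul_le_mul_of_nonneg_left hσb hε.le
        _ < ε' := by
          rw [div_lt_iff₀ (by positivity)] at hρ2
          rw [mul_div_assoc', div_lt_iff₀ (by positivity)]
          nlinarith
    have hφ0 : 0 ≤ φ x := (hpos x).le
    show -ε' < φ x - (ε * σ x + 0)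
    linarith
  -- the minimum principle
  have hge := hU₀.nonneg_of_dalembertian_nonpos D.h huc hu2 hΔu hbdry hinf
  -- hence `𝒰 · (φ ∘ Φ) ≥ ε / r` beyond `R`
  have hV : ∀ z : E3, R < ‖z‖ → ε * ‖z‖⁻¹ ≤ 𝒰 z * endValue e φ z := by
    intro z hz
    have hzR : e.R < ‖z‖ := hRe.trans hz
    have hz1 : R₁ < ‖z‖ := hRR₁.trans hz
    have hx : e.dataChart ⟨z, hzR⟩ ∈ e.far R := e.mem_far_iff.2 ⟨⟨z, hzR⟩, hz, rfl⟩
    have h := hge _ hx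
    have hcz : e.coord (e.dataChart ⟨z, hzR⟩) = z := e.coord_dataChart ⟨z, hzR⟩
    have hσz : σ (e.dataChart ⟨z, hzR⟩) = (𝒰 z * ‖z‖)⁻¹ := by rw [hσ_def]; simp only [hcz]
    have hu0 : 0 ≤ φ (e.dataChart ⟨z, hzR⟩) - (ε * (𝒰 z * ‖z‖)⁻¹ + 0) := by rw [← hσz]; exact h
    have h𝒰 : 0 < 𝒰 z := hHF.pos hz1
    have hz0 : 0 < ‖z‖ := hR0.trans hz
    rw [endValue_of_lt e φ hzR]
    rw [add_zero, sub_nonneg, mul_inv, ← mul_assoc] at hu0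
    calc ε * ‖z‖⁻¹ = ε * (𝒰 z)⁻¹ * ‖z‖⁻¹ * 𝒰 z := by field_simp
      _ ≤ φ (e.dataChart ⟨z, hzR⟩) * 𝒰 z := mul_le_mul_of_nonneg_right hu0 h𝒰.le
      _ = 𝒰 z * φ (e.dataChart ⟨z, hzR⟩) := mul_comm _ _
  -- and `b ≥ ε` from the expansion
  by_contra hb0
  have hbε : b < ε := lt_of_le_of_lt (le_of_not_gt hb0) hε
  obtain ⟨C, hC₀, hC⟩ := hb.exists_pos
  rw [IsBigOWith_def] at hC
  obtain ⟨z, ⟨hz₁, hz₂⟩, hz₃⟩ := ((hC.and (eventually_cobounded_lt_norm (E := E3) R)).and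
    (eventually_cobounded_lt_norm (E := E3) (C / (ε - b)))).exists
  have hz0 : 0 < ‖z‖ := hR0.trans hz₂
  have h1 : 𝒰 z * endValue e φ z - (0 + b * ‖z‖⁻¹) ≤ C * (‖z‖ ^ 2)⁻¹ := by
    have e2 : ‖‖z‖ ^ (-2 : ℝ)‖ = (‖z‖ ^ 2)⁻¹ := by
      rw [Real.norm_of_nonneg (Real.rpow_nonneg (norm_nonneg _) _), Real.rpow_neg (norm_nonneg _),
        Real.rpow_two]
    rw [← e2]
    exact (le_abs_self _).trans (by simpa only [Real.norm_eq_abs] using hz₁)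
  have h2 := hV z hz₂
  -- `(ε - b)/r ≤ C/r²`, i.e. `(ε - b) r ≤ C`, contradicting `r > C/(ε - b)`
  have h3 : (ε - b) * ‖z‖⁻¹ ≤ C * (‖z‖ ^ 2)⁻¹ := by
    have : ε * ‖z‖⁻¹ - b * ‖z‖⁻¹ ≤ C * (‖z‖ ^ 2)⁻¹ := by linarith
    linarith [sub_mul ε b ‖z‖⁻¹]
  have h4 : (ε - b) * ‖z‖ ≤ C := by
    have h3' := mul_le_mul_of_nonneg_right h3 (pow_nonneg hz0.le 2)
    calc (ε - b) * ‖z‖ = (ε - b) * ‖z‖⁻¹ * ‖z‖ ^ 2 := by field_simp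
      _ ≤ C * (‖z‖ ^ 2)⁻¹ * ‖z‖ ^ 2 := h3'
      _ = C := by field_simp
  have h5 : C < (ε - b) * ‖z‖ := by
    rw [div_lt_iff₀ (by linarith)] at hz₃
    linarith [mul_comm ‖z‖ (ε - b)]
  linarith

end IsHarmonicallyFlatWith

/-! ### Thm. 8 and Thm. 9 on the double without the maximum-principle hypotheses -/

section Corollaries

open Compactification

variable {X : Type} [TopologicalSpace X] [ChartedSpace E3 X] [IsManifold (𝓡 3) ∞ X]
  (e : AFEnd X)

omit [IsManifold (𝓡 3) ∞ X] in
/-- From one compact core to all: if the complement of `e₁.far T₂ ∪ e.far S₀` is compact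
(`T₂ > R(e₁)`, `S₀ > R(e)`) then `X` has exactly the two ends `e₁`, `e` in the sense of
`nonneg_of_dalembertian_le_twoEnds` (every complement of two far regions is compact).
[cite: BrayRPI2001, §2 Def. 1] -/
theorem isCompact_compl_far_union (e₁ : AFEnd X) {T₂ S₀ : ℝ} (hT₂ : e₁.R < T₂) (hS₀ : e.R < S₀)
    (hK : IsCompact ((e₁.far T₂)ᶜ ∩ (e.far S₀)ᶜ)) (R₁' R₂' : ℝ) :
    IsCompact (e₁.far R₁' ∪ e.far R₂')ᶜ := by
  rw [compl_union]
  have h1 : IsCompact ((e₁.far T₂)ᶜ ∩ (e.far R₂')ᶜ) := e.isCompact_compl_far_inter e₁ hS₀ R₂' hK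
  have h2 : IsCompact ((e.far R₂')ᶜ ∩ (e₁.far R₁')ᶜ) := by
    refine e₁.isCompact_compl_far_inter e hT₂ R₁' ?_
    rwa [inter_comm]
  rwa [inter_comm]

/-- **Bray's Thm. 8, (88), for two harmonically flat ends, modulo the positive mass theorem**
— the statement of `AFEnd.Bray2001_thm8_two_ends_of_positiveMass` with the hypotheses `φ > 0`
and "positive monopole coefficient" removed (they follow from the maximum principle:
`pos_of_harmonic_twoEnds`, `IsHarmonicallyFlatWith.monopole_pos_of_pos`). Remaining inputs
beyond the geometry of `(X, h)`: the `h`-harmonic `φ` of (86) with `φ → 0` in `e` and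
`φ ∘ Φ₁ = 1 − c/r + O(r⁻²)` in `e₁`, and `positive_mass_theorem_riemannian`. Conclusion:
`2c ≤ 2β` (`ℰ(ḡ) ≤ m̄`). [cite: BrayRPI2001, §6 Thm. 8 with (86)–(88) and its proof] -/
theorem Bray2001_thm8_two_ends_of_positiveMass' (hPMT : positive_mass_theorem_riemannian)
    [T2Space X] [SecondCountableTopology X] [ConnectedSpace X]
    (D : InitialDataSet (𝓡 3) X) [D.metric.HasLeviCivita] (hts : D.IsTimeSymmetric)
    (hR : ∀ x, 0 ≤ D.metric.scalarCurvature x)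
    {R₁ : ℝ} {𝒰 : E3 → ℝ} (hHF : e.IsHarmonicallyFlatWith D R₁ 𝒰)
    (e₁ : AFEnd X) {T₁ : ℝ} {𝒰₁ : E3 → ℝ} (hHF₁ : e₁.IsHarmonicallyFlatWith D T₁ 𝒰₁)
    {β : ℝ} (h𝒰₁ : HasHarmonicExpansion 𝒰₁ 1 β)
    {S₀ : ℝ} (hS₀ : e.R < S₀) (hdisj : Disjoint (e₁.U : Set X) (e.far S₀))
    {T₂ : ℝ} (hT₂ : e₁.R < T₂) (hK : IsCompact ((e₁.far T₂)ᶜ ∩ (e.far S₀)ᶜ))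
    (φ : X → ℝ) (hφ : ContMDiff (𝓡 3) 𝓘(ℝ) ∞ φ)
    (hΔ : ∀ x, D.metric.dalembertian φ x = 0) (hφ0 : TendstoAtEnd e φ 0) {c : ℝ}
    (hexp : (fun x ↦ endValue e₁ φ x - (1 - c / ‖x‖)) =O[cobounded E3] fun x ↦ ‖x‖ ^ (-2 : ℝ)) :
    2 * c ≤ 2 * β := by
  have h2le : ((2 : ℕ) : ℕ∞ω) ≤ ∞ := WithTop.coe_le_coe.mpr le_top
  have hφ2 : ContMDiff (𝓡 3) 𝓘(ℝ, ℝ) 2 φ := hφ.of_le h2le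
  have h1 : TendstoAtEnd e₁ φ 1 := (hasHarmonicExpansion_of_sub_div hexp).tendsto
  have htwo := e.isCompact_compl_far_union e₁ hT₂ hS₀ hK
  have hφpos : ∀ x, 0 < φ x := pos_of_harmonic_twoEnds D htwo hφ2 hΔ h1 hφ0
  have hb : ∀ b : ℝ, HasHarmonicExpansion (fun x ↦ 𝒰 x * endValue e φ x) 0 b → 0 < b :=
    fun b hb ↦ hHF.monopole_pos_of_pos hφ2 (R₂ := R₁) (fun y _ ↦ hΔ _) hφpos hb
  exact e.Bray2001_thm8_two_ends_of_positiveMass hPMT D hts hR hHF e₁ hHF₁ h𝒰₁ hS₀ hdisj hT₂ hK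
    φ hφ hφpos hΔ hφ0 hb hexp

/-- **Thm. 9 on the reflection-symmetric double, modulo the positive mass theorem and the
existence of the potential (81)** — the statement of
`AFEnd.half_horizonCapacity_le_admEnergy_of_symmetric_of_positiveMass` with the hypotheses
`φ > 0` and "positive monopole coefficient" removed. Remaining inputs beyond the geometry of the
double: the smooth `h`-harmonic `φ` with `φ → 0` in `e₂`, finite energy over `V` and
`φ ∘ Φ = 1 − c/r + O₁(r⁻²)` in `e`, and `positive_mass_theorem_riemannian`. Conclusion:
`½ ℰ(Σ, h) ≤ E_ADM(e)`. [cite: BrayRPI2001, §6 proof of Thm. 9 with Thm. 8 and (92)–(93)] -/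
theorem half_horizonCapacity_le_admEnergy_of_symmetric_of_positiveMass'
    (hPMT : positive_mass_theorem_riemannian)
    [T2Space X] [LocallyCompactSpace X] [SecondCountableTopology X] [ConnectedSpace X]
    [MeasurableSpace X] [BorelSpace X]
    (D : InitialDataSet (𝓡 3) X) [D.metric.HasLeviCivita] (hts : D.IsTimeSymmetric)
    (hR : ∀ x, 0 ≤ D.metric.scalarCurvature x) {e₂ : AFEnd X}
    {T₁ : ℝ} {𝒰₁ : E3 → ℝ} (hHF₁ : e.IsHarmonicallyFlatWith D T₁ 𝒰₁)
    {β : ℝ} (h𝒰₁ : HasHarmonicExpansion 𝒰₁ 1 β)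
    {R₂ : ℝ} {𝒰₂ : E3 → ℝ} (hHF₂ : e₂.IsHarmonicallyFlatWith D R₂ 𝒰₂)
    {S₀ : ℝ} (hS₀ : e₂.R < S₀) (hdisj : Disjoint (e.U : Set X) (e₂.far S₀))
    (htwo : ∀ R₁' R₂', IsCompact (e.far R₁' ∪ e₂.far R₂')ᶜ) (ι : Diffeomorph (𝓡 3) (𝓡 3) X X ∞)
    (hiso : ∀ (x : X) (v w : TangentSpace (𝓡 3) x),
      D.h.inner (ι x) (mfderiv (𝓡 3) (𝓡 3) ι x v) (mfderiv (𝓡 3) (𝓡 3) ι x w) = D.h.inner x v w)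
    (h₂₁ : ∀ (ψ : X → ℝ) (c : ℝ), TendstoAtEnd e₂ (ψ ∘ ι) c ↔ TendstoAtEnd e ψ c)
    (h₁₂ : ∀ (ψ : X → ℝ) (c : ℝ), TendstoAtEnd e (ψ ∘ ι) c ↔ TendstoAtEnd e₂ ψ c)
    {V : Opens X} (hV : IsExteriorRegion e V) (hfix : ∀ x ∈ frontier (V : Set X), ι x = x)
    {φ : X → ℝ} (hφ : ContMDiff (𝓡 3) 𝓘(ℝ, ℝ) ∞ φ)
    (hΔ : ∀ x, D.metric.dalembertian φ x = 0) (h0 : TendstoAtEnd e₂ φ 0)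
    (hfin : ∫⁻ x in (V : Set X), ENNReal.ofReal (gradNorm D.h φ x ^ 2) ∂riemannianMeasure D.h < ⊤)
    {c : ℝ}
    (hexp : (fun x ↦ endValue e φ x - (1 - c / ‖x‖)) =O[cobounded E3] fun x ↦ ‖x‖ ^ (-2 : ℝ))
    (hexp' : (fun x : E3 ↦ ‖fderiv ℝ (fun y ↦ endValue e φ y - (1 - c / ‖y‖)) x‖)
      =O[cobounded E3] fun x ↦ ‖x‖ ^ (-3 : ℝ)) :
    (horizonCapacity D.h e V).toReal / 2 ≤ e.admEnergy D := by
  have h2le : ((2 : ℕ) : ℕ∞ω) ≤ ∞ := WithTop.coe_le_coe.mpr le_top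
  have hφ2 : ContMDiff (𝓡 3) 𝓘(ℝ, ℝ) 2 φ := hφ.of_le h2le
  have h1 : TendstoAtEnd e φ 1 := (hasHarmonicExpansion_of_sub_div hexp).tendsto
  have hφpos : ∀ x, 0 < φ x := pos_of_harmonic_twoEnds D htwo hφ2 hΔ h1 h0
  have hb : ∀ b : ℝ, HasHarmonicExpansion (fun x ↦ 𝒰₂ x * endValue e₂ φ x) 0 b → 0 < b :=
    fun b hb ↦ hHF₂.monopole_pos_of_pos hφ2 (R₂ := R₂) (fun y _ ↦ hΔ _) hφpos hb
  exact e.half_horizonCapacity_le_admEnergy_of_symmetric_of_positiveMass hPMT D hts hR hHF₁ h𝒰₁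
    hHF₂ hS₀ hdisj htwo ι hiso h₂₁ h₁₂ hV hfix hφ hφpos hΔ h0 hb hfin hexp hexp'

end Corollaries

end AFEnd

end Literature.Geometry.Lorentzian

end
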